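/-
Copyright: statement-level skeleton of a published paper (lit-balaban cell, Phase-2 proof seat p30). No proof claims
beyond what the kernel checks below.
-/
import Mathlib

/-!
# `BalabanImbrieJaffe1984to88.BIJ85Eq625Proof` — T. Bałaban, J. Imbrie, A. Jaffe, *Renormalization of the Higgs model:
minimizers, propagators and the stability of mean field theory*, Commun. Math. Phys. **97** (1985) 299–329
[BalabanImbrieJaffe1985]: Sect. 6.2 *"u_k = u_{k+1} · Fluctuation (Modulo Gauge Transformation)"* — the exponent algebra of
(6.2.1)–(6.2.6), i.e. the decomposition **(6.2.5)** (= (6.3.1)) with the gauge function (6.2.6), PROVED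

statement-level skeleton of published theorems with citation tags; proofs where landed; nothing here is a claim about the Yang–Mills mass gap

PDF held: `paper:balaban1985-cmp97-bij-higgs-minimizers` (journal page = PDF page + 298).  Renders read as images: p. 313,
316, 317, 318, 319, 320 (`HOME/lit-balaban-r15/pages/1985-cmp97-bij-higgs-minimizers-p015,p019,p020,p021,p022-x2.png`,
`run/shared/lean/pub/pub-balaban/t4/b2b-balaban-t4-lit2/renders/bij1985/…-p018-x2.png`).

CITATION HEADER (lean-in-tree rule).  Part of the lit-balaban TYPED SKELETON (HOME `run/shared/lean/pub/lit-balaban/`):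
WHAT IS REPRODUCED = row **C1.Eq6.2.1-6.2.6** (and the restatement (6.3.1) of row C1.Eq6.3.1-6.3.4) of
`HOME/lit-balaban-r15/ROWS-C1.md` — sibling of `BIJ85Eq611Proof` ((6.1.1), reserve R6); seat p30, unit `lit-balaban-p30`.

THE PRINTED TEXT (verbatim, pp. 319–320 [PDF 21–22]).  *"6.2. u_k = u_{k+1} · Fluctuation (Modulo Gauge Transformation).
We now investigate the effect of the two translations defined in Sect. 6.1 on the field u_k. This allows us to separate a
fluctuation field and a gauge transformation which then leave u_{k+1}. Rewrite the definition of u_k (with u in place of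
v), so u_k = Q^{s*}_k u exp(−ie_kη𝒟_k∂^*Q^{e*}_kf^{(k)}). (6.2.1)  By (6.2) we have Q^{s*}_ku = (Q^{s*}_{k+1}v)e^{ie_kηQ^{s*}_kB′},
(6.2.2) so substituting this and (6.3) into (6.2.1) we obtain u_k = Q^{s*}_{k+1}v exp[ie_kηQ^{s*}_kB′ − ie_kη(𝒟_k∂^*Q^{e*}_k∂B′)
− ie_kηL^{−d/2}(𝒟_k∂^*Q^{e*}_{k+1}f^{(k+1)})]. (6.2.3)  We have the identity G_{k,Ax}∂^* = 𝒟_k∂^* + ∂D to replace 𝒟_k∂^* by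
G_{k,Ax}∂^*. Then we apply again the identity (5.3.1) to replace the first two terms in the exponential by ie_kηH_{k,Ax}B′.
This takes care of the first translation. The second translation (6.1.5) then yields u_k = Q^{s*}_{k+1}v exp[ie_kηH_{k,Ax}B −
ie_kηL^{−d/2}H_{k,Ax}C^{(k)}H_k^*∂^*Q^{e*}_{k+1}f^{(k+1)} − ie_kηL^{−d/2}(𝒟_k∂^*Q^{e*}_{k+1}f^{(k+1)})] · (gauge trans). (6.2.4)
We make another gauge transformation to replace the axial gauge minimizers by Landau gauge minimizers, and we combine
the second and third term into an operator 𝒟_{k+1}. After rescaling, the L^{−d/2} factor is absorbed and we have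
u_k = e^{ie_kηH_kB}u_{k+1} (the gauge transformation), (6.2.5) where the gauge transformation is generated by
exp[ie_kD(Q^{e*}_k∂B′) + ie_kλ_k(H_kB) − ie_kL^{−d/2}λ_k(H_kC^{(k)}H_k∂^*Q^{e*}_{k+1}f^{(k+1)})]. (6.2.6)"*;  p. 320 (Sect. 6.3):
*"In Sect. 6.2 we established the general decomposition (6.2.5) for u_k, u_k = u_{k+1}e^{ie_kηH_kB}e^{iη∂ω}, (6.3.1) where ω
denotes the gauge transformation (6.2.6)."*  Inputs quoted: (4.5.4) p. 313 *"(u_k)_b = (Q^{s*}_kv)_b exp[−ie_kη(𝒟_k∂^*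
Q^{e*}_kf^{(k)})_b]"*; (6.2)/(6.4) p. 318 *"u = u′Q^{s*}v, u′ = exp(ie_kB′)"*, *"f^{(k)}(p) = (∂B′)(p) + L^{−d/2}(Q^{e*}f^{(k+1)})(p)"*;
(5.2.6) p. 316 *"G_{k,Ax}∂^* − 𝒟_k∂^* = ∂D"* (Prop. 5.2.2; tree: `BIJ85Sect4Statements.Prop522Data.Prop522`); (5.3.1) p. 317
*"H_{k,Ax}B = Q^{s*}_kB − G_{k,Ax}∂^*Q^{e*}_k∂B"*; (5.1.1) p. 313 *"H_{k,Ax}B − H_kB = ∂λ"*, *"λ is an explicit, linear function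
of H_kB"* (Prop. 5.1.1; tree: `BIJ85Sect4Statements.GaugeRG.Prop511`); (4.4.4) p. 312 *"𝒟_k ≡ Σ_{j=0}^{k−1}H_jC^{(j)}H_j^*"*
(tree: `BIJ85Sect4Statements.curlyD`), whence 𝒟_{k+1} = 𝒟_k + H_kC^{(k)}H_k^*; (6.1.8) p. 319 *"B′ = B − L^{−d/2}C^{(k)}H_k^*∂^*
Q^{e*}_{k+1}f^{(k+1)}"*; p. 319 *"note that Q^eQ^e_k = Q^e_{k+1}"*.

THE TYPING (pure operator algebra, as in `BIJ85Eq611Proof` / `BIJ85Sect4Statements`).  `A` = η-lattice Lie-algebra (real)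
bond fields (additive; the exponents), `U` = the commutative group of U(1)-valued η-lattice bond fields (u_k, Q^{s*}_ku,
Q^{s*}_{k+1}v live here), `E : A → U` = the pointwise exponential a ↦ exp(ie_kη a) with `hE` : E(a + b) = E(a)E(b); `Bd` =
unit-lattice bond fields (B, B′), `P₁`, `PL`, `Pη` = unit-lattice, L-lattice, η-lattice plaquette fields, `Gf` = gauge functions with
`dg` = ∂ on gauge functions; the printed operators as real-linear maps: `Qss` = Q^{s*}_k (on Lie-algebra fields),
`Dk`/`Dk1` = 𝒟_k/𝒟_{k+1}, `dηs` = ∂^*, `Qeks` = Q^{e*}_k, `Qes` = Q^{e*}, `Qek1s` = Q^{e*}_{k+1}, `d₁` = ∂ (unit-lattice curl),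
`G` = G_{k,Ax}, `Hax`/`Hk`/`Hks` = H_{k,Ax}/H_k/H_k^*, `Ck` = C^{(k)}, `Dg` = the gauge-function-valued operator D of (5.2.6),
`lamk` = λ_k(·) of Prop. 5.1.1 (linear).  EVERY printed input is an explicit hypothesis named after its display (`h621`,
`h622`, `h64`, `h526`, `h531`, `h618`, `h511`, `h444`, `hQs`), the factor L^{−d/2} is a real `l`.  READING RECORDED
(transcript notes, located, all harmless for the algebra): T2 — p. 320 "The second translation (6.1.5)" is the
translation (6.1.8) ((6.1.5) is the identity ∂H_k = (I − ∂G∂^*)Q^{e*}_k∂); T3 — (6.2.6) prints "λ_k(H_kC^{(k)}H_k∂^*Q^{e*}_{k+1}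
f^{(k+1)})" where (6.2.4) has H_k^* (the typed ω carries H_k^* = `Hks`); T4 — the scalar prefactors: (6.2.5)/(6.3.1) write
e^{ie_kηH_kB} and e^{iη∂ω} while (6.2.6) writes ie_k(…) and still displays L^{−d/2} after "the L^{−d/2} factor is
absorbed": here NO rescaling is performed — every exponential is the single homomorphism `E` (= exp(ie_kη ·)) of a
Lie-algebra field, u_{k+1} is (4.5.4) at k+1 BEFORE rescaling, u_{k+1} := (Q^{s*}_{k+1}v)·E(−L^{−d/2}𝒟_{k+1}∂^*Q^{e*}_{k+1}
f^{(k+1)}) (`huk1`), and the gauge factor is E(∂ω) with ω the bracket of (6.2.6) without its prefactor ie_k.  WHAT IS PROVED: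
`eq623` ((6.2.3)), `eq624` (the exponent of (6.2.4) with its "(gauge trans)" made explicit: ∂D(Q^{e*}_k∂B′)), **`eq625`**
((6.2.5) with the gauge function (6.2.6), = (6.3.1)).  Carrier clauses (F6): the lattice maps behind Q^{s*}, Q^{e*}, ∂, ∂^*,
the exponential E, the functional-integral objects 𝒟_k, G_{k,Ax}, H_k, H_{k,Ax}, C^{(k)} and the gauge functions D, λ_k are
the instance's; NOTHING of the paper is asserted beyond the kernel-checked algebra below.
-/

namespace Literature.MathematicalPhysics.QuantumFieldTheory.BalabanImbrieJaffe1984to88.BIJ85Eq625Proof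

variable {A : Type*} [AddCommGroup A] [Module ℝ A]
variable {U : Type*} [CommGroup U]
variable {Bd : Type*} [AddCommGroup Bd] [Module ℝ Bd]
variable {P₁ : Type*} [AddCommGroup P₁] [Module ℝ P₁]
variable {PL : Type*} [AddCommGroup PL] [Module ℝ PL]
variable {Pη : Type*} [AddCommGroup Pη] [Module ℝ Pη]
variable {Gf : Type*} [AddCommGroup Gf] [Module ℝ Gf]

/-! ## (6.2.3): substituting (6.2.2) and (6.3)/(6.4) into (6.2.1) -/

/-- **(6.2.3)** p. 320 [PDF 22], verbatim: *"By (6.2) we have Q^{s*}_ku = (Q^{s*}_{k+1}v)e^{ie_kηQ^{s*}_kB′}, (6.2.2) so substituting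
this and (6.3) into (6.2.1) we obtain u_k = Q^{s*}_{k+1}v exp[ie_kηQ^{s*}_kB′ − ie_kη(𝒟_k∂^*Q^{e*}_k∂B′) − ie_kηL^{−d/2}(𝒟_k∂^*
Q^{e*}_{k+1}f^{(k+1)})]. (6.2.3)"* — PROVED from (6.2.1) `h621`, (6.2.2) `h622`, (6.4) `h64` (f^{(k)} = ∂B′ + L^{−d/2}Q^{e*}f^{(k+1)})
and Q^{e*}_kQ^{e*} = Q^{e*}_{k+1} `hQs`; `E` = exp(ie_kη ·) (homomorphism `hE`), L^{−d/2} = `l`.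
[cite: BalabanImbrieJaffe1985, (6.2.3) p.320] -/
theorem eq623 (E : A → U) (hE : ∀ a b, E (a + b) = E a * E b) (Qss : Bd →ₗ[ℝ] A) (Dk : A →ₗ[ℝ] A)
    (dηs : Pη →ₗ[ℝ] A) (Qeks : P₁ →ₗ[ℝ] Pη) (Qes : PL →ₗ[ℝ] P₁) (Qek1s : PL →ₗ[ℝ] Pη) (d₁ : Bd →ₗ[ℝ] P₁)
    (hQs : Qeks ∘ₗ Qes = Qek1s) (l : ℝ) (uk Qsu Qsv : U) (fk : P₁) (fL : PL) (B' : Bd)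
    (h621 : uk = Qsu * E (-(Dk (dηs (Qeks fk))))) (h622 : Qsu = Qsv * E (Qss B'))
    (h64 : fk = d₁ B' + l • Qes fL) :
    uk = Qsv * E (Qss B' - Dk (dηs (Qeks (d₁ B'))) - l • Dk (dηs (Qek1s fL))) := by
  have hQ : Qeks (Qes fL) = Qek1s fL := by simpa using LinearMap.congr_fun hQs fL
  rw [h621, h622, h64, map_add, map_smul, hQ, map_add, map_smul, map_add, map_smul, mul_assoc, ← hE]
  congr 2
  abel

/-! ## (6.2.4): Proposition 5.2.2, (5.3.1) and the translation (6.1.8) -/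

/-- **(6.2.4)** p. 320 [PDF 22], verbatim: *"We have the identity G_{k,Ax}∂^* = 𝒟_k∂^* + ∂D to replace 𝒟_k∂^* by G_{k,Ax}∂^*. Then
we apply again the identity (5.3.1) to replace the first two terms in the exponential by ie_kηH_{k,Ax}B′. This takes care of
the first translation. The second translation (6.1.5) then yields u_k = Q^{s*}_{k+1}v exp[ie_kηH_{k,Ax}B − ie_kηL^{−d/2}H_{k,Ax}
C^{(k)}H_k^*∂^*Q^{e*}_{k+1}f^{(k+1)} − ie_kηL^{−d/2}(𝒟_k∂^*Q^{e*}_{k+1}f^{(k+1)})] · (gauge trans). (6.2.4)"* — the EXPONENT identity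
PROVED, with the "(gauge trans)" made explicit as ∂D(Q^{e*}_k∂B′): Q^{s*}_kB′ − 𝒟_k∂^*Q^{e*}_k∂B′ − L^{−d/2}𝒟_k∂^*Q^{e*}_{k+1}f
= H_{k,Ax}B − L^{−d/2}H_{k,Ax}C^{(k)}H_k^*∂^*Q^{e*}_{k+1}f − L^{−d/2}𝒟_k∂^*Q^{e*}_{k+1}f + ∂D(Q^{e*}_k∂B′), from (5.2.6) `h526`,
(5.3.1) `h531`, (6.1.8) `h618` ("(6.1.5)" of the text = the translation (6.1.8), transcript note T2).
[cite: BalabanImbrieJaffe1985, (6.2.4) p.320] -/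
theorem eq624 (Qss : Bd →ₗ[ℝ] A) (Dk G : A →ₗ[ℝ] A) (dηs : Pη →ₗ[ℝ] A) (Qeks : P₁ →ₗ[ℝ] Pη)
    (Qek1s : PL →ₗ[ℝ] Pη) (d₁ : Bd →ₗ[ℝ] P₁) (Hax : Bd →ₗ[ℝ] A) (Hks : A →ₗ[ℝ] Bd) (Ck : Bd →ₗ[ℝ] Bd)
    (dg : Gf →ₗ[ℝ] A) (Dg : Pη →ₗ[ℝ] Gf)
    (h526 : ∀ J : Pη, G (dηs J) - Dk (dηs J) = dg (Dg J)) (h531 : Hax = Qss - G ∘ₗ dηs ∘ₗ Qeks ∘ₗ d₁)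
    (l : ℝ) (fL : PL) (B' B : Bd) (h618 : B = B' + l • Ck (Hks (dηs (Qek1s fL)))) :
    Qss B' - Dk (dηs (Qeks (d₁ B'))) - l • Dk (dηs (Qek1s fL))
      = Hax B - l • Hax (Ck (Hks (dηs (Qek1s fL)))) - l • Dk (dηs (Qek1s fL)) + dg (Dg (Qeks (d₁ B'))) := by
  -- 𝒟_k∂^*J = G_{k,Ax}∂^*J − ∂DJ with J = Q^{e*}_k∂B′, then (5.3.1): Q^{s*}_kB′ − G∂^*Q^{e*}_k∂B′ = H_{k,Ax}B′
  have hD : Dk (dηs (Qeks (d₁ B'))) = G (dηs (Qeks (d₁ B'))) - dg (Dg (Qeks (d₁ B'))) := by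
    rw [← h526]; abel
  have hHax : Hax B' = Qss B' - G (dηs (Qeks (d₁ B'))) := by
    rw [h531]; simp only [LinearMap.sub_apply, LinearMap.comp_apply]
  -- the translation (6.1.8): H_{k,Ax}B′ = H_{k,Ax}B − L^{−d/2}H_{k,Ax}C^{(k)}H_k^*∂^*Q^{e*}_{k+1}f
  have hB' : B' = B - l • Ck (Hks (dηs (Qek1s fL))) := by rw [h618]; abel
  have hHaxB' : Hax B' = Hax B - l • Hax (Ck (Hks (dηs (Qek1s fL)))) := by
    rw [hB', map_sub, map_smul]
  rw [hD, ← hHaxB', hHax]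
  abel

/-! ## (6.2.5)–(6.2.6) (= (6.3.1)): Landau gauge minimizers and 𝒟_{k+1} -/

/-- **(6.2.5)–(6.2.6)** p. 320 [PDF 22] (= **(6.3.1)**), verbatim: *"We make another gauge transformation to replace the axial
gauge minimizers by Landau gauge minimizers, and we combine the second and third term into an operator 𝒟_{k+1}. After
rescaling, the L^{−d/2} factor is absorbed and we have u_k = e^{ie_kηH_kB}u_{k+1} (the gauge transformation), (6.2.5) where
the gauge transformation is generated by exp[ie_kD(Q^{e*}_k∂B′) + ie_kλ_k(H_kB) − ie_kL^{−d/2}λ_k(H_kC^{(k)}H_k∂^*Q^{e*}_{k+1}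
f^{(k+1)})]. (6.2.6)"*; (6.3.1) p. 320: *"u_k = u_{k+1}e^{ie_kηH_kB}e^{iη∂ω}, where ω denotes the gauge transformation (6.2.6)"* —
PROVED in the commutative group of U(1)-valued η-lattice bond fields, with every exponential the homomorphism `E` =
exp(ie_kη ·) of a Lie-algebra field, NO rescaling (u_{k+1} := (Q^{s*}_{k+1}v)·E(−L^{−d/2}𝒟_{k+1}∂^*Q^{e*}_{k+1}f^{(k+1)}) = (4.5.4)
at k+1 before rescaling, `huk1`; transcript note T4) and ω = D(Q^{e*}_k∂B′) + λ_k(H_kB) − L^{−d/2}λ_k(H_kC^{(k)}H_k^*∂^*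
Q^{e*}_{k+1}f^{(k+1)}) (H_k^* as in (6.2.4), transcript note T3), from: (6.2.1) `h621`, (6.2.2) `h622`, (6.4) `h64`,
Q^{e*}_kQ^{e*} = Q^{e*}_{k+1} `hQs`, Prop. 5.2.2 (5.2.6) `h526`, (5.3.1) `h531`, the translation (6.1.8) `h618`, Prop. 5.1.1
(5.1.1) with λ = λ_k(H_kB) linear `h511`, and 𝒟_{k+1} = 𝒟_k + H_kC^{(k)}H_k^* ((4.4.4)) `h444`.
[cite: BalabanImbrieJaffe1985, (6.2.5)–(6.2.6) p.320] -/
theorem eq625 (E : A → U) (hE : ∀ a b, E (a + b) = E a * E b) (Qss : Bd →ₗ[ℝ] A) (Dk Dk1 G : A →ₗ[ℝ] A)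
    (dηs : Pη →ₗ[ℝ] A) (Qeks : P₁ →ₗ[ℝ] Pη) (Qes : PL →ₗ[ℝ] P₁) (Qek1s : PL →ₗ[ℝ] Pη) (d₁ : Bd →ₗ[ℝ] P₁)
    (Hax Hk : Bd →ₗ[ℝ] A) (Hks : A →ₗ[ℝ] Bd) (Ck : Bd →ₗ[ℝ] Bd) (dg : Gf →ₗ[ℝ] A) (Dg : Pη →ₗ[ℝ] Gf)
    (lamk : A →ₗ[ℝ] Gf)
    (hQs : Qeks ∘ₗ Qes = Qek1s) (h526 : ∀ J : Pη, G (dηs J) - Dk (dηs J) = dg (Dg J))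
    (h531 : Hax = Qss - G ∘ₗ dηs ∘ₗ Qeks ∘ₗ d₁) (h511 : ∀ b : Bd, Hax b - Hk b = dg (lamk (Hk b)))
    (h444 : Dk1 = Dk + Hk ∘ₗ Ck ∘ₗ Hks)
    (l : ℝ) (uk uk1 Qsu Qsv : U) (fk : P₁) (fL : PL) (B' B : Bd)
    (h621 : uk = Qsu * E (-(Dk (dηs (Qeks fk))))) (h622 : Qsu = Qsv * E (Qss B'))
    (h64 : fk = d₁ B' + l • Qes fL) (h618 : B = B' + l • Ck (Hks (dηs (Qek1s fL))))
    (huk1 : uk1 = Qsv * E (-(l • Dk1 (dηs (Qek1s fL))))) :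
    uk = uk1 * E (Hk B) *
      E (dg (Dg (Qeks (d₁ B')) + lamk (Hk B) - l • lamk (Hk (Ck (Hks (dηs (Qek1s fL))))))) := by
  rw [eq623 E hE Qss Dk dηs Qeks Qes Qek1s d₁ hQs l uk Qsu Qsv fk fL B' h621 h622 h64,
    eq624 Qss Dk G dηs Qeks Qek1s d₁ Hax Hks Ck dg Dg h526 h531 l fL B' B h618, huk1, mul_assoc, mul_assoc, ← hE, ← hE]
  -- Landau gauge minimizers (Prop. 5.1.1) and 𝒟_{k+1} = 𝒟_k + H_kC^{(k)}H_k^* in the exponent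
  have h1 : Hax B = Hk B + dg (lamk (Hk B)) := by rw [← h511]; abel
  have h2 : Hax (Ck (Hks (dηs (Qek1s fL)))) = Hk (Ck (Hks (dηs (Qek1s fL))))
      + dg (lamk (Hk (Ck (Hks (dηs (Qek1s fL)))))) := by rw [← h511]; abel
  have h3 : Dk1 (dηs (Qek1s fL)) = Dk (dηs (Qek1s fL)) + Hk (Ck (Hks (dηs (Qek1s fL)))) := by
    rw [h444]; simp only [LinearMap.add_apply, LinearMap.comp_apply]
  congr 2
  rw [h1, h2, h3, map_sub, map_add, map_smul, smul_add, smul_add]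
  abel

end Literature.MathematicalPhysics.QuantumFieldTheory.BalabanImbrieJaffe1984to88.BIJ85Eq625Proof
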